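/-
Copyright (c) 2026. All rights reserved.
Released under Apache 2.0 license as described in the file LICENSE.
Authors: abc-iut cell, prover seat abc-iut-w5-d017 (wave 5, gen 6).
-/
import Literature.IUT.LogVolume.UnitLogDyadicFourthPowers
import HarnessLib

/-!
# Roots of unity push the dyadic power criterion up: `ζ_{2^j} ∈ K`, `f = 1`, `2^{j+1} ∤ e` ⇒ no unit log is a unit

Proof-only sequel (theorems, no definitions) of `UnitLogDyadicPowerCriterion.lean` (for `f(K/ℚ₂) = 1`:
`‖L(y)‖ = 1` forces `‖1 − y‖ = ‖ϖ‖^s`, `2^k s = e`, `‖1 + y^{2^k}‖ = ‖ϖ‖^{ke}` with `k ≥ 2`) and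
`UnitLogDyadicFourthPowers.lean` (`√−1 ∈ K` ⇒ `k ≥ 3`).  GENERAL DESCENT along the `2`-power roots of unity:

* `three_le_and_norm_sub_or_add_of_norm_mul` — **descent step** (every unit principal): for a unit `θ` and any
  `w`, `‖(w − θ)(w + θ)‖ = ‖ϖ‖^{me}` with `m ≥ 2` forces `m ≥ 3` and `‖w ∓ θ‖ = ‖ϖ‖^{(m−1)e}` for one sign
  (the two factors differ by `2θ`; at `‖w − θ‖ = ‖2‖` one has `(w − θ)/2 ≡ 1 ≡ −θ`, so `‖w + θ‖ < ‖2‖`);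
* **`exists_pow_le_of_pow_two_pow_eq_neg_one`** — if `ζ^{2^{j+1}} = −1` in `K` (a primitive `2^{j+2}`-th root
  of unity: `j = 0` is `√−1`, `j = 1` is `ζ₈`, `j = 2` is `ζ₁₆`) and `‖L(y)‖ = 1`, then the criterion fires at
  some `k ≥ j + 3` (so `2^{j+3} ∣ e`): starting from `1 + y^{2^k} = (w − θ)(w + θ)`, `w = y^{2^{k−1}}`,
  `θ = ζ^{2^j}`, each descent replaces `(w, ±θ)` by square roots, available `j` more times;
* **`norm_unitLog_ne_one_of_pow_two_pow_eq_neg_one`** — COROLLARY: `f(K/ℚ₂) = 1`, `ζ^{2^{j+1}} = −1` in `K`,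
  `2^{j+3} ∤ e(K/ℚ₂)` ⇒ `‖log₂ u‖ ≠ 1` for every `u` — e.g. `ζ₈ ∈ K` and `16 ∤ e` (every `(8, 1)`-field
  containing `ζ₈`: `ℚ₂(ζ₁₆)`, `ℚ₂(ζ₈, √(ζ₈ − 1))`, `ℚ₂(√(5ζ₈))`), `ζ₁₆ ∈ K` and `32 ∤ e` (`ℚ₂(ζ₃₂)`, …); census
  forms `logUnits_inter_sphere_eq_empty_…`.

This contains abc-iut-S1's `ℚ₂(ζ₁₆)` theorem (`UnitLogCyclotomicSixteen.lean`, `e = 8`) and the `√−1`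
results (`UnitLogWildDyadicQuarticGaussian.lean`, `e = 4`; `UnitLogDyadicFourthPowers.lean`, `8 ∤ e`) as the
cases `j = 2, e = 8` and `j = 0`.  Classical (Neukirch, *Algebraic Number Theory* II (5.5)).  Nothing here is
disputed mathematics; no IUT statement is asserted; nothing bears on [IUTchIII] Cor. 3.12.
-/

noncomputable section

open Metric Set

namespace Literature.IUT.LogVolume

namespace RamificationCriterion

open Literature.NumberTheory.GaloisRepresentations.Ultrametric

variable {K : Type*} [NontriviallyNormedField K] [instK : NormedAlgebra ℚ_[2] K] [IsUltrametricDist K]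
  [ProperSpace K]

/-! ### §1. The descent step -/

/-- **Descent step** (every unit principal): `θ` a unit, `‖(w − θ)(w + θ)‖ = ‖ϖ‖^{me}`, `m ≥ 2` ⇒ `m ≥ 3` and
`‖w − θ‖ = ‖ϖ‖^{(m−1)e}` or `‖w + θ‖ = ‖ϖ‖^{(m−1)e}`. [cite: NeukirchANT1999, Ch. II (5.5)] -/
theorem three_le_and_norm_sub_or_add_of_norm_mul {ϖ : Kˣ} (hϖ : IsUniformizer ϖ)
    (hprinc : ∀ u : K, ‖u‖ = 1 → IsPrincipal u) {θ : K} (hθ : ‖θ‖ = 1) (w : K) {m : ℤ} (hm : 2 ≤ m)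
    (h : ‖(w - θ) * (w + θ)‖ = ‖(ϖ : K)‖ ^ (m * absRamificationIdx 2 K)) :
    3 ≤ m ∧ (‖w - θ‖ = ‖(ϖ : K)‖ ^ ((m - 1) * absRamificationIdx 2 K) ∨
      ‖w + θ‖ = ‖(ϖ : K)‖ ^ ((m - 1) * absRamificationIdx 2 K)) := by
  have hρ0 : 0 < ‖(ϖ : K)‖ := norm_units_pos ϖ
  set e : ℕ := absRamificationIdx 2 K with he_def
  have he : (0 : ℤ) < e := by exact_mod_cast absRamificationIdx_pos 2 K
  have hinj : ∀ {a b : ℤ}, ‖(ϖ : K)‖ ^ a = ‖(ϖ : K)‖ ^ b → a = b :=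
    fun h ↦ zpow_right_injective₀ hρ0 hϖ.1.ne h
  have hltiff : ∀ {a b : ℤ}, ‖(ϖ : K)‖ ^ a < ‖(ϖ : K)‖ ^ b ↔ b < a :=
    zpow_lt_zpow_iff_right_of_lt_one₀ hρ0 hϖ.1
  have h2 : ‖(2 : K)‖ = ‖(ϖ : K)‖ ^ (e : ℤ) := norm_two_eq_zpow hϖ
  have h20 : (2 : K) ≠ 0 := by
    intro h0; rw [h0, norm_zero] at h2; exact (zpow_pos hρ0 _).ne h2
  have h2θ : ‖2 * θ‖ = ‖(ϖ : K)‖ ^ (e : ℤ) := by rw [norm_mul, hθ, mul_one, h2]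
  have hB : w + θ = (w - θ) + 2 * θ := by ring
  have hsplit : ‖(ϖ : K)‖ ^ (m * e) = ‖(ϖ : K)‖ ^ (e : ℤ) * ‖(ϖ : K)‖ ^ ((m - 1) * e) := by
    rw [← zpow_add₀ hρ0.ne']; congr 1; ring
  rw [norm_mul] at h
  rcases lt_trichotomy ‖w - θ‖ (‖(ϖ : K)‖ ^ (e : ℤ)) with hlt | heq | hgt
  · -- `‖w − θ‖ < ‖2θ‖`: `‖w + θ‖ = ‖2θ‖`, so `‖w − θ‖ = ‖ϖ‖^{(m−1)e} < ‖ϖ‖^e`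
    have hplus : ‖w + θ‖ = ‖(ϖ : K)‖ ^ (e : ℤ) := by
      rw [hB, IsUltrametricDist.norm_add_eq_max_of_norm_ne_norm (by rw [h2θ]; exact hlt.ne), h2θ,
        max_eq_right hlt.le]
    rw [hplus, hsplit, mul_comm] at h
    have hA : ‖w - θ‖ = ‖(ϖ : K)‖ ^ ((m - 1) * e) := mul_left_cancel₀ (zpow_pos hρ0 _).ne' h
    refine ⟨?_, Or.inl hA⟩
    rw [hA, hltiff] at hlt
    nlinarith
  · -- `‖w − θ‖ = ‖2‖`: `(w − θ)/2 ≡ 1 ≡ −θ`, so `‖w + θ‖ < ‖2‖`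
    have hd : ‖(w - θ) / 2‖ = 1 := by rw [norm_div, heq, h2, div_self (zpow_pos hρ0 _).ne']
    have hdP : ‖1 - (w - θ) / 2‖ < 1 := hprinc _ hd
    have hθP : ‖1 - θ‖ < 1 := hprinc _ hθ
    have hsum : w + θ = 2 * (2 + -(1 - (w - θ) / 2) + -(1 - θ)) := by field_simp; ring
    have hlt2 : ‖(2 : K) + -(1 - (w - θ) / 2) + -(1 - θ)‖ < 1 := by
      have h2lt : ‖(2 : K)‖ < 1 := by exact_mod_cast norm_prime_lt_one 2 K
      refine (IsUltrametricDist.norm_add_le_max _ _).trans_lt (max_lt ?_ (by rwa [norm_neg]))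
      exact (IsUltrametricDist.norm_add_le_max _ _).trans_lt (max_lt h2lt (by rwa [norm_neg]))
    have hplus : ‖w + θ‖ < ‖(ϖ : K)‖ ^ (e : ℤ) := by
      rw [hsum, norm_mul, h2]
      calc ‖(ϖ : K)‖ ^ (e : ℤ) * ‖(2 : K) + -(1 - (w - θ) / 2) + -(1 - θ)‖
          < ‖(ϖ : K)‖ ^ (e : ℤ) * 1 := mul_lt_mul_of_pos_left hlt2 (zpow_pos hρ0 _)
        _ = ‖(ϖ : K)‖ ^ (e : ℤ) := mul_one _
    rw [heq, hsplit] at h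
    have hBn : ‖w + θ‖ = ‖(ϖ : K)‖ ^ ((m - 1) * e) := mul_left_cancel₀ (zpow_pos hρ0 _).ne' h
    refine ⟨?_, Or.inr hBn⟩
    rw [hBn, hltiff] at hplus
    nlinarith
  · -- `‖w − θ‖ > ‖2θ‖`: `‖w + θ‖ = ‖w − θ‖`, product `‖w − θ‖² = ‖ϖ‖^{me}` with `me < 2e`: absurd
    exfalso
    have hplus : ‖w + θ‖ = ‖w - θ‖ := by
      rw [hB, IsUltrametricDist.norm_add_eq_max_of_norm_ne_norm (by rw [h2θ]; exact hgt.ne'), h2θ,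
        max_eq_left hgt.le]
    rw [hplus] at h
    have hlt2 : ‖(ϖ : K)‖ ^ (e : ℤ) * ‖(ϖ : K)‖ ^ (e : ℤ) < ‖w - θ‖ * ‖w - θ‖ :=
      mul_lt_mul'' hgt hgt (zpow_pos hρ0 _).le (zpow_pos hρ0 _).le
    rw [h, ← zpow_add₀ hρ0.ne', hltiff] at hlt2
    nlinarith

/-! ### §2. Iterated descent along the `2`-power roots of unity -/

/-- The descent invariant after `t ≤ j` steps: `k = a + t + 1` with `a ≥ 2`, and `y^{2^a}` is at distance
exactly `‖ϖ‖^{ae}` from an odd power of `ζ^{2^{j−t}}`. [cite: NeukirchANT1999, Ch. II (5.5)] -/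
private theorem descent_iter {ϖ : Kˣ} (hϖ : IsUniformizer ϖ) (hprinc : ∀ u : K, ‖u‖ = 1 → IsPrincipal u)
    {ζ : K} {j : ℕ} (hζ : ζ ^ (2 ^ (j + 1)) = -1) {y : K} {k : ℕ} (hk : 2 ≤ k)
    (hplus : ‖1 + y ^ (2 ^ k)‖ = ‖(ϖ : K)‖ ^ ((k : ℤ) * absRamificationIdx 2 K)) :
    ∀ t : ℕ, t ≤ j → ∃ a b : ℕ, a + t + 1 = k ∧ b + t = j ∧ 2 ≤ a ∧ ∃ c : ℕ, Odd c ∧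
      ‖y ^ (2 ^ a) - ζ ^ (c * 2 ^ b)‖ = ‖(ϖ : K)‖ ^ ((a : ℤ) * absRamificationIdx 2 K) := by
  set e : ℕ := absRamificationIdx 2 K with he_def
  have hζ1 : ‖ζ‖ = 1 := by
    have h : ‖ζ‖ ^ (2 ^ (j + 1)) = 1 := by rw [← norm_pow, hζ, norm_neg, norm_one]
    exact (pow_eq_one_iff_of_nonneg (norm_nonneg ζ) (pow_ne_zero _ two_ne_zero)).mp h
  have hζtop : ζ ^ (2 ^ (j + 2)) = 1 := by
    rw [pow_succ, pow_mul, hζ]; norm_num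
  have hunit : ∀ c b : ℕ, ‖ζ ^ (c * 2 ^ b)‖ = 1 := fun c b ↦ by rw [norm_pow, hζ1, one_pow]
  -- `−ζ^{c 2^b} = ζ^{(c + 2^{j+2−b}) 2^b}` for `b ≤ j + 1`... we use it in the form below
  have hneg : ∀ c b : ℕ, b ≤ j + 1 → -ζ ^ (c * 2 ^ b) = ζ ^ ((c + 2 ^ (j + 1 - b)) * 2 ^ b) := by
    intro c b hb
    have hsplit : (c + 2 ^ (j + 1 - b)) * 2 ^ b = c * 2 ^ b + 2 ^ (j + 1) := by
      rw [add_mul, ← pow_add, Nat.sub_add_cancel hb]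
    rw [hsplit, pow_add, hζ]; ring
  have hodd : ∀ c b : ℕ, b ≤ j → Odd c → Odd (c + 2 ^ (j + 1 - b)) := by
    intro c b hb hc
    obtain ⟨d, hd⟩ : ∃ d, j + 1 - b = d + 1 := ⟨j - b, by omega⟩
    rw [hd, pow_succ]
    exact hc.add_even ⟨2 ^ d, by ring⟩
  intro t
  induction t with
  | zero =>
    intro _
    -- `1 + y^{2^k} = (w − θ)(w + θ)`, `w = y^{2^{k−1}}`, `θ = ζ^{2^j}`
    obtain ⟨a, rfl⟩ : ∃ a, k = a + 1 := ⟨k - 1, by omega⟩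
    have hθsq : (ζ ^ (1 * 2 ^ j)) ^ 2 = -1 := by rw [one_mul, ← pow_mul, ← pow_succ, hζ]
    have hfac : (1 : K) + y ^ (2 ^ (a + 1)) = (y ^ (2 ^ a) - ζ ^ (1 * 2 ^ j)) * (y ^ (2 ^ a) + ζ ^ (1 * 2 ^ j)) := by
      rw [pow_succ, pow_mul]; linear_combination hθsq
    rw [hfac] at hplus
    obtain ⟨h3, hor⟩ := three_le_and_norm_sub_or_add_of_norm_mul hϖ hprinc (hunit 1 j) _
      (by push_cast; omega) hplus
    refine ⟨a, j, by omega, by omega, by push_cast at h3; omega, ?_⟩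
    have hexp : (((a + 1 : ℕ) : ℤ) - 1) * e = (a : ℤ) * e := by push_cast; ring
    rw [hexp] at hor
    rcases hor with hm | hp
    · exact ⟨1, odd_one, hm⟩
    · refine ⟨1 + 2 ^ (j + 1 - j), hodd 1 j le_rfl odd_one, ?_⟩
      rw [← hneg 1 j (by omega), sub_neg_eq_add]
      exact hp
  | succ t ih =>
    intro ht
    obtain ⟨a, b, hak, hbj, ha2, c, hc, hnorm⟩ := ih (by omega)
    obtain ⟨a', rfl⟩ : ∃ a', a = a' + 1 := ⟨a - 1, by omega⟩
    obtain ⟨b', rfl⟩ : ∃ b', b = b' + 1 := ⟨b - 1, by omega⟩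
    -- `y^{2^{a'+1}} − ζ^{c 2^{b'+1}} = (w' − θ')(w' + θ')`
    have hfac : y ^ (2 ^ (a' + 1)) - ζ ^ (c * 2 ^ (b' + 1))
        = (y ^ (2 ^ a') - ζ ^ (c * 2 ^ b')) * (y ^ (2 ^ a') + ζ ^ (c * 2 ^ b')) := by
      have h1 : y ^ (2 ^ (a' + 1)) = (y ^ (2 ^ a')) ^ 2 := by rw [pow_succ, pow_mul]
      have h2 : ζ ^ (c * 2 ^ (b' + 1)) = (ζ ^ (c * 2 ^ b')) ^ 2 := by rw [← pow_mul]; congr 1; ring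
      rw [h1, h2]; ring
    rw [hfac] at hnorm
    obtain ⟨h3, hor⟩ := three_le_and_norm_sub_or_add_of_norm_mul hϖ hprinc (hunit c b') _
      (by push_cast; omega) hnorm
    refine ⟨a', b', by omega, by omega, by push_cast at h3; omega, ?_⟩
    have hexp : (((a' + 1 : ℕ) : ℤ) - 1) * e = (a' : ℤ) * e := by push_cast; ring
    rw [hexp] at hor
    rcases hor with hm | hp
    · exact ⟨c, hc, hm⟩
    · refine ⟨c + 2 ^ (j + 1 - b'), hodd c b' (by omega) hc, ?_⟩
      rw [← hneg c b' (by omega), sub_neg_eq_add]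
      exact hp

/-- **Roots of unity push the criterion up**: every unit principal, `ζ^{2^{j+1}} = −1` in `K`, `‖L(y)‖ = 1` ⇒
the power criterion fires at some `k ≥ j + 3`: `‖1 − y‖ = ‖ϖ‖^s`, `2^k s = e`, `‖1 + y^{2^k}‖ = ‖ϖ‖^{ke}`.
[cite: NeukirchANT1999, Ch. II (5.5)] -/
theorem exists_pow_le_of_pow_two_pow_eq_neg_one {ϖ : Kˣ} (hϖ : IsUniformizer ϖ)
    (hprinc : ∀ u : K, ‖u‖ = 1 → IsPrincipal u) {ζ : K} {j : ℕ} (hζ : ζ ^ (2 ^ (j + 1)) = -1) {y : K}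
    (hyP : IsPrincipal y) (h1 : ‖logSeries y‖ = 1) :
    ∃ k : ℕ, j + 3 ≤ k ∧ ∃ s : ℤ, 1 ≤ s ∧ 2 ^ k * s = (absRamificationIdx 2 K : ℤ) ∧
      ‖1 - y‖ = ‖(ϖ : K)‖ ^ s ∧
      ‖1 + y ^ (2 ^ k)‖ = ‖(ϖ : K)‖ ^ ((k : ℤ) * absRamificationIdx 2 K) := by
  obtain ⟨k, hk, s, hs1, hks, hy, hplus⟩ := exists_pow_of_norm_logSeries_eq_one hϖ hprinc hyP h1
  obtain ⟨a, b, hak, hbj, ha2, -⟩ := descent_iter hϖ hprinc hζ hk hplus j le_rfl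
  exact ⟨k, by omega, s, hs1, hks, hy, hplus⟩

/-! ### §3. Corollaries on units -/

/-- `2^k s = e` with `s ≥ 1` and `k ≥ n` ⇒ `2^n ∣ e`. [folklore] -/
private theorem two_pow_dvd_of_eq {k n : ℕ} {s : ℤ} {e : ℕ} (hkn : n ≤ k) (hs : 1 ≤ s)
    (hks : 2 ^ k * s = (e : ℤ)) : 2 ^ n ∣ e := by
  obtain ⟨d, rfl⟩ := Nat.exists_eq_add_of_le hkn
  refine ⟨(2 ^ d * s).toNat, ?_⟩
  have hs0 : (0 : ℤ) ≤ 2 ^ d * s := by positivity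
  zify
  rw [Int.toNat_of_nonneg hs0, ← hks, pow_add]
  ring

/-- **`f(K/ℚ₂) = 1`, `ζ^{2^{j+1}} = −1` in `K`, `2^{j+3} ∤ e(K/ℚ₂)` ⇒ `‖L(y)‖ ≠ 1` for every principal unit `y`.**
[cite: NeukirchANT1999, Ch. II (5.5)] -/
theorem norm_logSeries_ne_one_of_pow_two_pow_eq_neg_one (hf : residueDegree 2 K = 1) {ζ : K} {j : ℕ}
    (hζ : ζ ^ (2 ^ (j + 1)) = -1) (hdvd : ¬ 2 ^ (j + 3) ∣ absRamificationIdx 2 K) {y : K}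
    (hyP : IsPrincipal y) : ‖logSeries y‖ ≠ 1 := by
  intro h1
  obtain ⟨ϖ, hϖ⟩ := exists_isUniformizer (F := K)
  obtain ⟨k, hk, s, hs1, hks, -, -⟩ := exists_pow_le_of_pow_two_pow_eq_neg_one hϖ
    (fun _ hu ↦ WildDyadic.isPrincipal_of_residueDegree_eq_one hf hu) hζ hyP h1
  exact hdvd (two_pow_dvd_of_eq hk hs1 hks)

/-- **`f(K/ℚ₂) = 1`, `ζ^{2^{j+1}} = −1` in `K` (a primitive `2^{j+2}`-th root of unity), `2^{j+3} ∤ e(K/ℚ₂)`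
⇒ `‖log₂ u‖ ≠ 1` for every `u : K`.**  `j = 0`: `√−1`, `8 ∤ e`; `j = 1`: `ζ₈`, `16 ∤ e` (so every `(8,1)`-field
containing `ζ₈`, e.g. `ℚ₂(ζ₁₆)`); `j = 2`: `ζ₁₆`, `32 ∤ e`. [cite: NeukirchANT1999, Ch. II (5.5)] -/
theorem norm_unitLog_ne_one_of_pow_two_pow_eq_neg_one (hf : residueDegree 2 K = 1) {ζ : K} {j : ℕ}
    (hζ : ζ ^ (2 ^ (j + 1)) = -1) (hdvd : ¬ 2 ^ (j + 3) ∣ absRamificationIdx 2 K) (u : K) :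
    ‖unitLog u‖ ≠ 1 := by
  by_cases hu : ‖u‖ = 1
  · obtain ⟨m, hm0, hmp, hmP⟩ := exists_pow_isPrincipal_not_dvd (p := 2) hu
    rw [unitLog_eq_inv_mul_logSeries 2 hm0 hmP, norm_mul, norm_inv,
      norm_natCast_eq_one_of_not_dvd 2 hmp, inv_one, one_mul]
    exact norm_logSeries_ne_one_of_pow_two_pow_eq_neg_one hf hζ hdvd hmP
  · rw [unitLog_of_norm_ne_one hu, norm_zero]
    exact zero_ne_one

/-- Census form: `log₂(𝒪_K^×)` MISSES the unit sphere. [cite: NeukirchANT1999, Ch. II (5.5)] -/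
theorem logUnits_inter_sphere_eq_empty_of_pow_two_pow_eq_neg_one (hf : residueDegree 2 K = 1) {ζ : K}
    {j : ℕ} (hζ : ζ ^ (2 ^ (j + 1)) = -1) (hdvd : ¬ 2 ^ (j + 3) ∣ absRamificationIdx 2 K) :
    logUnits K ∩ sphere 0 1 = ∅ := by
  ext z
  simp only [mem_inter_iff, mem_sphere_zero_iff_norm, mem_empty_iff_false, iff_false, not_and]
  rintro ⟨u, -, rfl⟩
  exact norm_unitLog_ne_one_of_pow_two_pow_eq_neg_one hf hζ hdvd u

/-- … so the "second iterate" of `log₂` on units has EMPTY domain there. [cite: NeukirchANT1999, Ch. II (5.5)] -/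
theorem unitLog_image_logUnits_inter_sphere_eq_empty_of_pow_two_pow_eq_neg_one (hf : residueDegree 2 K = 1)
    {ζ : K} {j : ℕ} (hζ : ζ ^ (2 ^ (j + 1)) = -1) (hdvd : ¬ 2 ^ (j + 3) ∣ absRamificationIdx 2 K) :
    unitLog '' (logUnits K ∩ sphere 0 1) = ∅ := by
  rw [logUnits_inter_sphere_eq_empty_of_pow_two_pow_eq_neg_one hf hζ hdvd, image_empty]

/-- **`ζ₈ ∈ K` (`ζ⁴ = −1`), `f = 1`, `e = 8` ⇒ `‖log₂ u‖ ≠ 1` for all `u`** — in particular `ℚ₂(ζ₁₆)` (abc-iut-S1's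
`UnitLogCyclotomicSixteen.lean`), `ℚ₂(ζ₈, √(ζ₈ − 1))`, `ℚ₂(√(5ζ₈))`. [cite: NeukirchANT1999, Ch. II (5.5)] -/
theorem norm_unitLog_ne_one_of_pow_four_eq_neg_one_of_eight (hf : residueDegree 2 K = 1)
    (he : absRamificationIdx 2 K = 8) {ζ : K} (hζ : ζ ^ 4 = -1) (u : K) : ‖unitLog u‖ ≠ 1 :=
  norm_unitLog_ne_one_of_pow_two_pow_eq_neg_one (j := 1) hf (by simpa using hζ) (by rw [he]; decide) u

end RamificationCriterion

end Literature.IUT.LogVolume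

end
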